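import Summits.HubbardSuperconductivity.HubbardSuperconductivity.Theses.NodalWardXY
import Literature.MathematicalPhysics.QuantumLattice.BdGBondHamiltonianTorus
import Literature.MathematicalPhysics.QuantumLattice.XYOrderDischarges

/-!
# Crux `VisonPairCost` (item `stmt-HubbardSuperconductivity-1266`, route `NodalWardXY`): the vison-string
BdG Hamiltonian as a `bdgTorus`, and Z₂ gauge invariance of its ground energy — support lemmas from the
standing disprover

The crux compares the many-body ground energies of the inline `d`-wave BdG Hamiltonians `H R` on the
fermionic torus `(ℤ/Lℤ)²` whose hopping AND singlet pairing on the `R` vertical bonds leaving `(a,0)`,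
`a < R`, carry the sign `−1` (a Z₂ string = two visons at plaquettes `(R−1,0)`, `(L−1,0)`).  This file
proves, for every `L ≥ 1`, all `μ, Δ₀, R`:

* `signedBondSum_eq_bdgTorus` — for ANY real bond field `s`, the signed bond sum
  `Σ_{x,i} s(x,i)•[−Σ_σ(c†_x c_{x+eᵢ} + h.c.) + Δ₀gᵢ(P + P†)] − μN` is the tree's
  `bdgTorus L (−s) (s Δ₀ g) μ` (`BdGBondHamiltonianTorus`); in particular it is Hermitian
  (`isHermitian_bdgTorus`), so `Matrix.groundEnergy` is its least eigenvalue;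
* `cruxHamiltonian_eq_bdgTorus`, `visonPairCost_iff_bdgTorus` — the crux decl
  `NodalWardXY.VisonPairCost` restated verbatim over `bdgTorus` with the string field
  `s_R(x,i) = if i = 1 ∧ x₁ = 0 ∧ x₀ < R then −1 else 1`;
* `groundEnergy_bdgTorus_z2Gauge` — **Z₂ gauge invariance**: for real bond data `(τ, Δ)` and any
  `ε : sites → {±1}`, `E₀(bdgTorus (ε_x ε_{x+eᵢ} τ) (ε_x ε_{x+eᵢ} Δ)) = E₀(bdgTorus τ Δ)` (conjugation by
  the unitary `phaseGauge` with values `±1`: hopping picks up `ε_x conj ε_y = ε_x ε_y` and singlet pairing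
  `conj(ε_x ε_y) = ε_x ε_y`, `phaseGauge_mul_bdgTorus_mul_conjTranspose`).  Hence the vison-pair cost of
  the crux depends only on the gauge class of `s_R` (plaquette fluxes and the two holonomies): the string
  may be deformed along any lattice path between the two visons — the freedom every line of attack on the
  item (branched cover, force telescoping, spin smearing) and every numerical test uses.
  (`groundEnergy_unitary_conj'` decouples the two `DecidableEq` instance paths that exist at the concrete
  fermionic torus — `instDecidableEqLex` versus `LinearOrder.toDecidableEq` — which are equal but not
  definitionally.)

Sources: T. Senthil, M. P. A. Fisher, PRB 62 (2000) 7850, §III (visons as Z₂ fluxes for the BdG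
quasiparticles; gauge classes) [SenthilFisher2000]; O. Vafek, A. Melikyan, M. Franz, Z. Tešanović,
PRB 63 (2001) 134509, App. A (A1)–(A2) (bond data and gauge covariance of the lattice d-wave BdG
Hamiltonian) [VafekEtAl2001]; T. Koma, H. Tasaki, PRL 68 (1992) 3248, eq. (5) (site-phase gauge
transformation) [KomaTasakiPRL1992].  Tree: `bdgTorus`, `bdgTorus_ofReal`, `isHermitian_bdgTorus`,
`phaseGauge_mul_bdgTorus_mul_conjTranspose` (`BdGBondHamiltonianTorus`), `phaseGauge`
(`MagneticHubbardTorus`), `Matrix.groundEnergy_unitary_conj` (`XYOrderDischarges`).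
-/

noncomputable section

set_option linter.dupNamespace false

namespace Summit.HubbardSuperconductivity.HubbardSuperconductivity.Theorems.VisonPairCost.Negative

open Matrix Finset Literature.MathematicalPhysics.QuantumLattice Literature.Probability.LatticeModels
open Summit.HubbardSuperconductivity.HubbardSuperconductivity.Theses.NodalWardXY
open scoped ComplexConjugate

variable (L : ℕ) [NeZero L]

/-! ### The signed bond sum is a `bdgTorus` -/

/-- For any REAL bond field `s`, the signed `d`-wave bond sum of the crux is the tree's BdG Hamiltonian
with bond data `τ = −s`, `Δ = s Δ₀ g`, `g = (+1, −1)`. [cite: VafekEtAl2001, App. A eq. (A1)] -/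
theorem signedBondSum_eq_bdgTorus (s : TorusSite 2 L → Fin 2 → ℝ) (μ Δ₀ : ℝ) :
    ((∑ x : TorusSite 2 L, ∑ i : Fin 2, ((s x i : ℝ) : ℂ) •
        ((∑ σ : Fin 2, -((annihilation (orb (FermionTorus.ofTorusSite x) σ))ᴴ * annihilation (orb
          (FermionTorus.ofTorusSite (x + Pi.single i 1)) σ) + (annihilation (orb
          (FermionTorus.ofTorusSite (x + Pi.single i 1)) σ))ᴴ * annihilation (orb
          (FermionTorus.ofTorusSite x) σ))) + ((Δ₀ * (if i = 0 then (1 : ℝ) else -1) : ℝ) : ℂ) •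
          ((annihilation (orb (FermionTorus.ofTorusSite x) 0) * annihilation (orb
          (FermionTorus.ofTorusSite (x + Pi.single i 1)) 1) - annihilation (orb
          (FermionTorus.ofTorusSite x) 1) * annihilation (orb (FermionTorus.ofTorusSite (x +
          Pi.single i 1)) 0)) + (annihilation (orb (FermionTorus.ofTorusSite x) 0) *
          annihilation (orb (FermionTorus.ofTorusSite (x + Pi.single i 1)) 1) - annihilation
          (orb (FermionTorus.ofTorusSite x) 1) * annihilation (orb (FermionTorus.ofTorusSite (x
          + Pi.single i 1)) 0))ᴴ))) -
        (μ : ℂ) • totalNumber : Matrix (Finset (Orb (FermionTorus 2 L))) (Finset (Orb (FermionTorus 2 L))) ℂ) =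
      bdgTorus L (fun x i => ((-(s x i) : ℝ) : ℂ))
        (fun x i => ((s x i * (Δ₀ * (if i = 0 then (1 : ℝ) else -1)) : ℝ) : ℂ)) μ := by
  rw [bdgTorus_ofReal]
  congr 1
  refine Finset.sum_congr rfl fun x _ => Finset.sum_congr rfl fun i _ => ?_
  simp only [torusBondHop_eq, torusBondPair_eq, Matrix.conjTranspose_mul, Matrix.conjTranspose_sub,
    annihilation_conjTranspose, creation_conjTranspose, smul_add, smul_sub, Finset.smul_sum, smul_neg,
    smul_smul, Complex.ofReal_neg, Complex.ofReal_mul, neg_smul, Finset.sum_add_distrib,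
    Finset.sum_neg_distrib, neg_add_rev]
  abel

/-- The complex sign of the crux is the cast of the real sign. [folklore] -/
theorem ite_neg_one_eq_ofReal (c : Prop) [Decidable c] :
    (if c then (-1 : ℂ) else 1) = (((if c then (-1 : ℝ) else 1) : ℝ) : ℂ) := by
  split_ifs <;> simp

/-- The crux's inline Hamiltonian `H R` (string field `s_R(x,i) = −1` iff `i = 1 ∧ x₁ = 0 ∧ x₀ < R`) is the
BdG Hamiltonian `bdgTorus L (−s_R) (s_R Δ₀ g) μ`. [cite: VafekEtAl2001, App. A eq. (A1)] -/
theorem cruxHamiltonian_eq_bdgTorus (μ Δ₀ : ℝ) (R : ℕ) :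
    ((∑ x : TorusSite 2 L, ∑ i : Fin 2, (if i = 1 ∧ x 1 = 0 ∧ (x 0).val < R then (-1 : ℂ) else 1) •
        ((∑ σ : Fin 2, -((annihilation (orb (FermionTorus.ofTorusSite x) σ))ᴴ * annihilation (orb
          (FermionTorus.ofTorusSite (x + Pi.single i 1)) σ) + (annihilation (orb
          (FermionTorus.ofTorusSite (x + Pi.single i 1)) σ))ᴴ * annihilation (orb
          (FermionTorus.ofTorusSite x) σ))) + ((Δ₀ * (if i = 0 then (1 : ℝ) else -1) : ℝ) : ℂ) •
          ((annihilation (orb (FermionTorus.ofTorusSite x) 0) * annihilation (orb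
          (FermionTorus.ofTorusSite (x + Pi.single i 1)) 1) - annihilation (orb
          (FermionTorus.ofTorusSite x) 1) * annihilation (orb (FermionTorus.ofTorusSite (x +
          Pi.single i 1)) 0)) + (annihilation (orb (FermionTorus.ofTorusSite x) 0) *
          annihilation (orb (FermionTorus.ofTorusSite (x + Pi.single i 1)) 1) - annihilation
          (orb (FermionTorus.ofTorusSite x) 1) * annihilation (orb (FermionTorus.ofTorusSite (x
          + Pi.single i 1)) 0))ᴴ))) -
        (μ : ℂ) • totalNumber : Matrix (Finset (Orb (FermionTorus 2 L))) (Finset (Orb (FermionTorus 2 L))) ℂ) =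
      bdgTorus L (fun x i => ((-(if i = 1 ∧ x 1 = 0 ∧ (x 0).val < R then (-1 : ℝ) else 1) : ℝ) : ℂ))
        (fun x i => (((if i = 1 ∧ x 1 = 0 ∧ (x 0).val < R then (-1 : ℝ) else 1) * (Δ₀ * (if i = 0 then (1 : ℝ) else -1)) : ℝ) : ℂ)) μ := by
  rw [← signedBondSum_eq_bdgTorus L (fun x i => if i = 1 ∧ x 1 = 0 ∧ (x 0).val < R then (-1 : ℝ) else 1)]
  simp only [ite_neg_one_eq_ofReal]

/-- **The crux over `bdgTorus`** (verbatim re-expression): `VisonPairCost` says that the ground energies of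
`bdgTorus L (−s_R) (s_R Δ₀ g) μ` and `bdgTorus L (−1) (Δ₀ g) μ` (`s_0 ≡ 1`) differ by at most `C(μ,Δ₀)`,
uniformly in `L ≥ 4` and `2R ≤ L`. [cite: SenthilFisher2000, §III] -/
theorem visonPairCost_iff_bdgTorus :
    VisonPairCost ↔
      ∀ μ : ℝ, μ ∈ Set.Ioo (-4 : ℝ) 4 → μ ≠ 0 → ∀ Δ₀ : ℝ, 0 < Δ₀ → ∃ C : ℝ,
        ∀ (L : ℕ) [NeZero L], 4 ≤ L → ∀ R : ℕ, 2 * R ≤ L →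
          |(bdgTorus L (fun x i => ((-(if i = 1 ∧ x 1 = 0 ∧ (x 0).val < R then (-1 : ℝ) else 1) : ℝ) : ℂ))
        (fun x i => (((if i = 1 ∧ x 1 = 0 ∧ (x 0).val < R then (-1 : ℝ) else 1) * (Δ₀ * (if i = 0 then (1 : ℝ) else -1)) : ℝ) : ℂ)) μ).groundEnergy -
            (bdgTorus L (fun x i => ((-(if i = 1 ∧ x 1 = 0 ∧ (x 0).val < 0 then (-1 : ℝ) else 1) : ℝ) : ℂ))
        (fun x i => (((if i = 1 ∧ x 1 = 0 ∧ (x 0).val < 0 then (-1 : ℝ) else 1) * (Δ₀ * (if i = 0 then (1 : ℝ) else -1)) : ℝ) : ℂ)) μ).groundEnergy| ≤ C := by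
  unfold VisonPairCost
  simp only [cruxHamiltonian_eq_bdgTorus]

/-! ### Z₂ gauge invariance of the ground energy -/

/-- `phaseGauge g` is unitary. [cite: KomaTasakiPRL1992, eq. (5)] -/
theorem phaseGauge_mem_unitaryGroup {Λ : Type*} [LinearOrder Λ] [Fintype Λ] (g : Λ → Circle) :
    phaseGauge g ∈ Matrix.unitaryGroup (Finset (Orb Λ)) ℂ := by
  rw [Matrix.mem_unitaryGroup_iff, Matrix.star_eq_conjTranspose, phaseGauge, Matrix.diagonal_conjTranspose,
    Matrix.diagonal_mul_diagonal, ← Matrix.diagonal_one]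
  congr 1
  funext s
  rw [Pi.star_apply, Complex.star_def, ← Circle.coe_inv_eq_conj, ← Circle.coe_mul, mul_inv_cancel,
    Circle.coe_one]

/-- `Matrix.groundEnergy_unitary_conj` with the `DecidableEq` instances of the hypothesis and of the
conclusion decoupled (`Subsingleton`; at the concrete fermionic torus the two synthesis paths are not
definitionally equal). [folklore] -/
theorem groundEnergy_unitary_conj' {n : Type*} [Fintype n] {d₁ : DecidableEq n} (d₂ : DecidableEq n)
    {A U : Matrix n n ℂ} (hU : U ∈ @Matrix.unitaryGroup n d₁ _ ℂ _ _) :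
    @Matrix.groundEnergy n _ d₂ (U * A * Uᴴ) = @Matrix.groundEnergy n _ d₂ A := by
  have e : d₁ = d₂ := Subsingleton.elim _ _
  subst e
  exact Matrix.groundEnergy_unitary_conj hU

/-- `−1 = e^{iπ}` on the unit circle, as a complex number. [folklore] -/
theorem coe_circleExp_pi : ((Circle.exp Real.pi : Circle) : ℂ) = -1 := by
  rw [Circle.coe_exp, Complex.exp_pi_mul_I]

/-- The `U(1)` site function of a Z₂ gauge transformation `ε` takes the real values `∓1`. [folklore] -/
theorem coe_ite_circleExp_pi (b : Bool) :
    (((if b then Circle.exp Real.pi else 1 : Circle)) : ℂ) = (((if b then (-1 : ℝ) else 1) : ℝ) : ℂ) := by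
  cases b <;> simp

/-- **Z₂ gauge invariance of the BdG ground energy** for real bond data: multiplying hopping and pairing
of each bond `(x, x+eᵢ)` by `ε_x ε_{x+eᵢ}`, `ε : sites → {±1}`, does not change `Matrix.groundEnergy`
(conjugation by the unitary `phaseGauge` of the `U(1)` site function `x ↦ ε_x`; for singlet pairing the
hopping factor `ε_x conj ε_y` and the pairing factor `conj(ε_x ε_y)` coincide for real `ε`).  In particular
the ground energies entering `VisonPairCost` depend only on the gauge class of the string field
(plaquette fluxes and holonomies). [cite: SenthilFisher2000, §III] -/
theorem groundEnergy_bdgTorus_z2Gauge (ε : TorusSite 2 L → Bool) (τ Δ : TorusSite 2 L → Fin 2 → ℝ)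
    (μ : ℝ) :
    (bdgTorus L
        (fun x i => (((if ε x then (-1 : ℝ) else 1) * (if ε (x + Pi.single i 1) then (-1 : ℝ) else 1) *
          τ x i : ℝ) : ℂ))
        (fun x i => (((if ε x then (-1 : ℝ) else 1) * (if ε (x + Pi.single i 1) then (-1 : ℝ) else 1) *
          Δ x i : ℝ) : ℂ)) μ).groundEnergy =
      (bdgTorus L (fun x i => ((τ x i : ℝ) : ℂ)) (fun x i => ((Δ x i : ℝ) : ℂ)) μ).groundEnergy := by
  have key := phaseGauge_mul_bdgTorus_mul_conjTranspose L
    (fun x => if ε x then Circle.exp Real.pi else 1) (fun x i => ((τ x i : ℝ) : ℂ))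
    (fun x i => ((Δ x i : ℝ) : ℂ)) μ
  simp only [coe_ite_circleExp_pi, Complex.conj_ofReal] at key
  have hτ : (fun x i => (((if ε x then (-1 : ℝ) else 1) : ℝ) : ℂ) *
        (((if ε (x + Pi.single i 1) then (-1 : ℝ) else 1) : ℝ) : ℂ) * ((τ x i : ℝ) : ℂ)) =
      (fun x i => (((if ε x then (-1 : ℝ) else 1) * (if ε (x + Pi.single i 1) then (-1 : ℝ) else 1) *
          τ x i : ℝ) : ℂ)) := by
    funext x i; push_cast; ring
  have hΔ : (fun x i => (((if ε x then (-1 : ℝ) else 1) : ℝ) : ℂ) *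
        (((if ε (x + Pi.single i 1) then (-1 : ℝ) else 1) : ℝ) : ℂ) * ((Δ x i : ℝ) : ℂ)) =
      (fun x i => (((if ε x then (-1 : ℝ) else 1) * (if ε (x + Pi.single i 1) then (-1 : ℝ) else 1) *
          Δ x i : ℝ) : ℂ)) := by
    funext x i; push_cast; ring
  rw [hτ, hΔ] at key
  rw [← key]
  exact groundEnergy_unitary_conj' _
    (phaseGauge_mem_unitaryGroup (fun u : FermionTorus 2 L => if ε u.toTorusSite then Circle.exp Real.pi else 1))

end Summit.HubbardSuperconductivity.HubbardSuperconductivity.Theorems.VisonPairCost.Negative
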